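import Literature.AnabelianGeometry.SemiGraphs.ProSigmaCompletionDehnTwistGenusZeroFour
import Literature.AnabelianGeometry.SemiGraphs.ProSigmaCompletionSemidirectDecomposition
import Literature.AnabelianGeometry.SemiGraphs.PSCTwoTripodOrigin
import Literature.AnabelianGeometry.AbsoluteAnabelian.AbsTopII.DPSCIndexDataOfEmbedding
import HarnessLib

/-!
# [AbsTopII] Def 1.2 (ii) with a NON-LOOP node: the DPSC datum of the two-tripod degeneration, every `Σ`

S. Mochizuki, *Topics in Absolute Anabelian Geometry II* [AbsTopII] (bib `MochizukiAbsTopII2013`; locators =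
PDF pages of the kurims manuscript `paper:url-585b8d0ad0d9`), §1, Example 1.1 (ii)/(iii) p. 9, Def 1.2 (ii)
p. 10: the DPSC-extension `1 → Π_𝔾 → Π_H = Π_𝔾 ⋊^{out} H → H → 1` of a stable log curve over a log point and
its verticial / edge-like subgroups; [CombGC] (`MochizukiCombGC2007`) Def 1.1 (ii) pp. 6–7.

MODEL/CONSTRUCTION file (definitions; abc-iut-f-066 gen 5, row «P13-TWO-VERTEX-NODAL-MODEL»; cell layer L4,
[AbsTopII] Prop 1.3 non-vacuity column).  The DEGENERATING 4-POINTED SPHERE: two irreducible components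
(two tripods `v_A`, `v_B`), ONE node `e` joining them (not a loop), cusps `c₁, c₂` on `v_A` and `c₃, c₀` on
`v_B`; the log inertia `I ≅ Ẑ^Σ` acts on `Π_𝔾` by the DEHN TWIST along the node.  Abstract-group model, for
EVERY set of primes `Σ`:

* `TwoTripodNodal.Model Σ` — the INPUT: a twist `φ : ℤ → Aut Γ_{0,4}` whose `φ(1)` is the Dehn twist along
  `c₁c₂` (`c₁, c₂` fixed, `c₃, c₀` conjugated by `c₁c₂`) and a pro-`Σ` completion `ι : Γ_{0,4} ⋊_φ ℤ → P`
  with profinite `P` (INHABITED for every `Σ`: abc-iut-f-066 gen 4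
  `SemidirectCofinal.exists_dehnTwist_extension_proSigmaCompletion`, p458766 — `Model.nonempty`);
* `Model.PiG = Π_𝔾 := closure ι(inl Γ_{0,4})`, `Model.κG : Γ_{0,4} → Π_𝔾` (a pro-`Σ` completion, gen 4
  `isProSigmaCompletion_closure_inl_genusZero_four_node₁₂`), `Model.T := closure ι(inr ℤ)` (the completed
  section — the inertia of `v_A`), `Model.U := closure ι⟨inl (c₁c₂)⁻¹ · inr 1⟩` (the twisted section — the
  inertia of `v_B`);
* `Model.pscDatum : PSCDatum Π_𝔾` — layer L3's [CombGC] Def 1.1 (ii) interface at TWO-TRIPOD SHAPE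
  (`PSCTwoTripodOrigin.lean`: `Π_{v_A} = closure κG⟨c₁, c₁c₂⟩`, `Π_{v_B} = closure κG⟨c₁c₂, c₃⟩`,
  `Π_e = closure κG⟨c₁c₂⟩`, `Π_{c_j} = closure κG⟨c_j⟩`, genera `0`);
* `Model.dpsc : DPSCIndexData` — abc-iut-f-069's `DPSCIndexData.ofEmbedding` of `pscDatum` along
  `Π_𝔾 ↪ P` with `Π_H = Π_I := P` (`H = I ≅ Ẑ^Σ`) and `Σ`-index `i^Σ_e := 1` (Ex 1.1 (iii): a regular
  smoothing).
The [AbsTopII] Prop 1.3 clauses at `dpsc` are PROVED in the proof-only companions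
`AbsTopII/TwoTripodNodalProp13*.lean`; nothing is asserted here.
HONEST FRAMING: a constructed datum (constructed ≠ geometric: that these closed subgroups ARE the groups of the
degenerate curve is the model's label — Riemann existence / log specialisation are not in the tree); no side
taken on [IUTchIII] Cor 3.12.
-/

noncomputable section

open scoped Pointwise

namespace Literature.AnabelianGeometry.AbsoluteAnabelian.AbsTopII.TwoTripodNodal

open Literature.AnabelianGeometry.SemiGraphs
open Literature.AnabelianGeometry.SemiGraphs.SemiGraphOfAnabelioids (IsProSigmaCompletion)
open Literature.AnabelianGeometry.SemiGraphs.SemiGraphOfAnabelioids.IsProSigmaCompletion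
open Literature.AnabelianGeometry.Anabelioids (IsSigmaInteger)
open Literature.GroupTheory.CombinatorialGroupTheory
open Literature.GroupTheory.CombinatorialGroupTheory.PuncturedSurfaceGroup
open _root_.Topology

/-- **The input of the two-vertex nodal model** for the set of primes `Σ`: a twist `φ : ℤ → Aut Γ_{0,4}` with
`φ(1)` the Dehn twist along the node `c₁c₂` (`c₁ ↦ c₁`, `c₂ ↦ c₂`, `c_j ↦ (c₁c₂) c_j (c₁c₂)⁻¹` for `j = 3, 0`),
a profinite group `P` and a pro-`Σ` completion `ι : Γ_{0,4} ⋊_φ ℤ → P` («`Π_H = Π_I`» of the degenerating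
4-pointed sphere over the log point, Def 1.2 (ii)). [cite: MochizukiAbsTopII2013, Def 1.2 (ii) p.10] -/
structure Model (Sigma : Set ℕ) : Type 1 where
  /-- the twist `φ : ℤ → Aut Γ_{0,4}` -/
  φ : Multiplicative ℤ →* MulAut (PuncturedSurfaceGroup 0 4)
  /-- `Π_H = Π_I`, a profinite group -/
  P : ProfiniteGrp.{0}
  /-- the pro-`Σ` completion map `Γ_{0,4} ⋊_φ ℤ → Π_H` -/
  ι : (PuncturedSurfaceGroup 0 4 ⋊[φ] Multiplicative ℤ) →* P
  /-- `φ(1)` fixes `c₁` -/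
  twist_c_one : φ (Multiplicative.ofAdd (1 : ℤ)) (c 1) = c 1
  /-- `φ(1)` fixes `c₂` -/
  twist_c_two : φ (Multiplicative.ofAdd (1 : ℤ)) (c 2) = c 2
  /-- `φ(1)` conjugates `c₃` by the node element `c₁c₂` -/
  twist_c_three : φ (Multiplicative.ofAdd (1 : ℤ)) (c 3) = c 1 * c 2 * c 3 * (c 1 * c 2)⁻¹
  /-- `φ(1)` conjugates `c₀` by the node element `c₁c₂` -/
  twist_c_zero : φ (Multiplicative.ofAdd (1 : ℤ)) (c 0) = c 1 * c 2 * c 0 * (c 1 * c 2)⁻¹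
  /-- `ι` is a pro-`Σ` completion -/
  isProSigmaCompletion : IsProSigmaCompletion Sigma ι

namespace Model

variable {Sigma : Set ℕ} (M : Model Sigma)

/-- **The model input exists for every `Σ`** (abc-iut-f-066 gen 4: the Dehn twist on `PuncturedSurfaceGroup 0 4`
and a pro-`Σ` completion of the twisted extension). [cite: MochizukiAbsTopII2013, Def 1.2 (ii) p.10] -/
theorem nonempty (Sigma : Set ℕ) : Nonempty (Model Sigma) := by
  obtain ⟨φ, P, ι, h1, h2, h3, h0, hι, -⟩ := SemidirectCofinal.exists_dehnTwist_extension_proSigmaCompletion Sigma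
  exact ⟨⟨φ, P, ι, h1, h2, h3, h0, hι⟩⟩

/-- **`Π_𝔾 := closure ι(inl Γ_{0,4})`**, the PSC-fundamental group of the model inside `Π_H = P`.
[cite: MochizukiAbsTopII2013, Def 1.2 (ii) p.10] -/
def PiG : Subgroup M.P :=
  ((SemidirectProduct.inl : PuncturedSurfaceGroup 0 4 →*
    PuncturedSurfaceGroup 0 4 ⋊[M.φ] Multiplicative ℤ).range.map M.ι).topologicalClosure

/-- **`T := closure ι(inr ℤ)`**, the completed section (the copy of `I ≅ Ẑ^Σ` centralising `Π_{v_A}`).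
[cite: MochizukiAbsTopII2013, Prop 1.3 (iii) p.11] -/
def T : Subgroup M.P :=
  ((SemidirectProduct.inr : Multiplicative ℤ →*
    PuncturedSurfaceGroup 0 4 ⋊[M.φ] Multiplicative ℤ).range.map M.ι).topologicalClosure

/-- **`U := closure ι⟨inl (c₁c₂)⁻¹ · inr 1⟩`**, the twisted section (the copy of `I` centralising `Π_{v_B}`).
[cite: MochizukiAbsTopII2013, Prop 1.3 (iii) p.11] -/
def U : Subgroup M.P :=
  (Subgroup.zpowers (M.ι (SemidirectProduct.inl (c 1 * c 2 : PuncturedSurfaceGroup 0 4)⁻¹ *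
    SemidirectProduct.inr (Multiplicative.ofAdd (1 : ℤ))))).topologicalClosure

/-- **`κG : Γ_{0,4} → Π_𝔾`**, the restriction of `ι ∘ inl` to its closed image (a pro-`Σ` completion of
`Γ_{0,4}`). [cite: MochizukiSemiAnbd2006, Ex. 2.10 p.31] -/
def κG : PuncturedSurfaceGroup 0 4 →* ↥M.PiG :=
  ((Subgroup.inclusion (Subgroup.le_topologicalClosure
    ((SemidirectProduct.inl : PuncturedSurfaceGroup 0 4 →*
      PuncturedSurfaceGroup 0 4 ⋊[M.φ] Multiplicative ℤ).range.map M.ι))).comp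
    (M.ι.subgroupMap (SemidirectProduct.inl : PuncturedSurfaceGroup 0 4 →*
      PuncturedSurfaceGroup 0 4 ⋊[M.φ] Multiplicative ℤ).range)).comp
    (MonoidHom.ofInjective (SemidirectProduct.inl_injective (φ := M.φ))).toMonoidHom

/-- `κG x = ι(inl x)` as elements of `P`. [cite: MochizukiSemiAnbd2006, Ex. 2.10 p.31] -/
@[simp] theorem coe_κG (x : PuncturedSurfaceGroup 0 4) : (M.κG x : M.P) = M.ι (SemidirectProduct.inl x) := rfl

/-- `κG : Γ_{0,4} → Π_𝔾` is a pro-`Σ` completion (abc-iut-f-066 gen 4, node₁₂ theorem).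
[cite: MochizukiSemiAnbd2006, Ex. 2.10 p.31] -/
theorem isProSigmaCompletion_κG : IsProSigmaCompletion Sigma M.κG :=
  SemidirectCofinal.isProSigmaCompletion_closure_inl_genusZero_four_node₁₂ M.twist_c_one M.twist_c_two
    M.twist_c_three M.twist_c_zero M.isProSigmaCompletion

/-- `Π_𝔾` is closed. [cite: MochizukiAbsTopII2013, Def 1.2 (ii) p.10] -/
theorem isClosed_PiG : IsClosed (M.PiG : Set M.P) := Subgroup.isClosed_topologicalClosure _

/-- `Π_𝔾` is normal in `Π_H`. [cite: MochizukiAbsTopII2013, Def 1.2 (ii) p.10] -/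
theorem normal_PiG : M.PiG.Normal := SemidirectCofinal.normal_closure_map_range_inl M.φ M.isProSigmaCompletion.dense

/-- `Π_𝔾` is pro-`Σ`. [cite: MochizukiCombGC2007, Def 1.1(ii) p.6] -/
theorem isProSigma_PiG : IsProSigma Sigma ↥M.PiG :=
  ⟨fun U _ p hp hdvd => (M.isProSigmaCompletion_κG.index_open U.toSubgroup inferInstance U.isOpen').2 p hp hdvd⟩

/-! ### The two-tripod PSC datum over `Π_𝔾` -/

/-- The dual semi-graph of the degenerating 4-pointed sphere: two vertices `v_A = 0`, `v_B = 1`, one node joining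
them, cusps `c₁, c₂` at `v_A` and `c₃, c₀` at `v_B`. [cite: MochizukiAbsTopII2013, Ex 1.1 (ii) p.9] -/
abbrev graph : PSCSemiGraph where
  V := Fin 2
  N := Unit
  C := Fin 4
  nodeEnds _ := s((0 : Fin 2), (1 : Fin 2))
  cuspEnd := ![(1 : Fin 2), 0, 0, 1]

/-- `Π_{v_A} := closure κG⟨c₁, c₁c₂⟩` (`∋ κG c₂`). [cite: MochizukiCombGC2007, Def 1.1(ii) p.6] -/
def vertGpA : Subgroup ↥M.PiG :=
  ((Subgroup.closure ({c 1, c 1 * c 2} : Set (PuncturedSurfaceGroup 0 4))).map M.κG).topologicalClosure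

/-- `Π_{v_B} := closure κG⟨c₁c₂, c₃⟩` (`∋ κG c₀`). [cite: MochizukiCombGC2007, Def 1.1(ii) p.6] -/
def vertGpB : Subgroup ↥M.PiG :=
  ((Subgroup.closure ({c 1 * c 2, c 3} : Set (PuncturedSurfaceGroup 0 4))).map M.κG).topologicalClosure

/-- `Π_e := closure κG⟨c₁c₂⟩`, the nodal subgroup. [cite: MochizukiCombGC2007, Def 1.1(ii) p.7] -/
def nodeGp : Subgroup ↥M.PiG :=
  ((Subgroup.zpowers (c 1 * c 2 : PuncturedSurfaceGroup 0 4)).map M.κG).topologicalClosure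

/-- `Π_{c_j} := closure κG⟨c_j⟩`, the cuspidal subgroups. [cite: MochizukiCombGC2007, Def 1.1(ii) p.7] -/
def cuspGp (j : Fin 4) : Subgroup ↥M.PiG :=
  ((PuncturedSurfaceGroup.cuspInertia (g := 0) j).map M.κG).topologicalClosure

/-- `c₁c₂ ∈ ⟨c₁, c₁c₂⟩` (the node lies on `v_A`). [cite: MochizukiAbsTopII2013, Ex 1.1 (ii) p.9] -/
theorem node_mem_closureA : (c 1 * c 2 : PuncturedSurfaceGroup 0 4) ∈
    Subgroup.closure ({c 1, c 1 * c 2} : Set (PuncturedSurfaceGroup 0 4)) :=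
  Subgroup.subset_closure (Or.inr rfl)

/-- `c₁c₂ ∈ ⟨c₁c₂, c₃⟩` (the node lies on `v_B`). [cite: MochizukiAbsTopII2013, Ex 1.1 (ii) p.9] -/
theorem node_mem_closureB : (c 1 * c 2 : PuncturedSurfaceGroup 0 4) ∈
    Subgroup.closure ({c 1 * c 2, c 3} : Set (PuncturedSurfaceGroup 0 4)) :=
  Subgroup.subset_closure (Or.inl rfl)

/-- `c₁ ∈ ⟨c₁, c₁c₂⟩`. [cite: MochizukiAbsTopII2013, Ex 1.1 (ii) p.9] -/
theorem c_one_mem_closureA : (c 1 : PuncturedSurfaceGroup 0 4) ∈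
    Subgroup.closure ({c 1, c 1 * c 2} : Set (PuncturedSurfaceGroup 0 4)) :=
  Subgroup.subset_closure (Or.inl rfl)

/-- `c₂ = c₁⁻¹ (c₁c₂) ∈ ⟨c₁, c₁c₂⟩`. [cite: MochizukiAbsTopII2013, Ex 1.1 (ii) p.9] -/
theorem c_two_mem_closureA : (c 2 : PuncturedSurfaceGroup 0 4) ∈
    Subgroup.closure ({c 1, c 1 * c 2} : Set (PuncturedSurfaceGroup 0 4)) := by
  have h1 : (c 1 : PuncturedSurfaceGroup 0 4) ∈ Subgroup.closure ({c 1, c 1 * c 2} : Set (PuncturedSurfaceGroup 0 4)) :=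
    Subgroup.subset_closure (Or.inl rfl)
  have h12 : (c 1 * c 2 : PuncturedSurfaceGroup 0 4) ∈
      Subgroup.closure ({c 1, c 1 * c 2} : Set (PuncturedSurfaceGroup 0 4)) :=
    Subgroup.subset_closure (Or.inr rfl)
  have h := Subgroup.mul_mem _ (Subgroup.inv_mem _ h1) h12
  rwa [inv_mul_cancel_left] at h

/-- `c₃ ∈ ⟨c₁c₂, c₃⟩`. [cite: MochizukiAbsTopII2013, Ex 1.1 (ii) p.9] -/
theorem c_three_mem_closureB : (c 3 : PuncturedSurfaceGroup 0 4) ∈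
    Subgroup.closure ({c 1 * c 2, c 3} : Set (PuncturedSurfaceGroup 0 4)) :=
  Subgroup.subset_closure (Or.inr rfl)

/-- `c₀ = (c₁c₂c₃)⁻¹ ∈ ⟨c₁c₂, c₃⟩`. [cite: MochizukiAbsTopII2013, Ex 1.1 (ii) p.9] -/
theorem c_zero_mem_closureB : (c 0 : PuncturedSurfaceGroup 0 4) ∈
    Subgroup.closure ({c 1 * c 2, c 3} : Set (PuncturedSurfaceGroup 0 4)) := by
  rw [c_zero_eq_inv]
  exact Subgroup.inv_mem _ (Subgroup.mul_mem _ (Subgroup.subset_closure (Or.inl rfl))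
    (Subgroup.subset_closure (Or.inr rfl)))

/-- **The two-tripod PSC datum over `Π_𝔾`** ([CombGC] Def 1.1 (ii) interface of layer L3, two-tripod SHAPE of
`PSCTwoTripodOrigin.lean`): `Σ`, the graph `v_A — e — v_B` with cusps `c₁, c₂ | c₃, c₀`, representatives
`Π_{v_A}, Π_{v_B}, Π_e, Π_{c_j}` as above (branch inclusions with conjugating element `1`), genera `0`, `Π_𝔾`
pro-`Σ`. [cite: MochizukiCombGC2007, Def 1.1(ii) pp.6-7] -/
def pscDatum (hne : Sigma.Nonempty) (hprime : ∀ p ∈ Sigma, p.Prime) : PSCDatum ↥M.PiG where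
  Sigma := Sigma
  sigma_prime := hprime
  sigma_nonempty := hne
  graph := graph
  vertGp := ![M.vertGpA, M.vertGpB]
  nodeGp _ := M.nodeGp
  cuspGp := M.cuspGp
  genus _ := 0
  isClosed_vertGp v := by
    fin_cases v <;> exact Subgroup.isClosed_topologicalClosure _
  isClosed_nodeGp _ := Subgroup.isClosed_topologicalClosure _
  isClosed_cuspGp _ := Subgroup.isClosed_topologicalClosure _
  nodeGp_le _ := ⟨(0 : Fin 2), (1 : Fin 2), rfl,
    ⟨1, by
      rw [one_smul]
      exact Subgroup.topologicalClosure_mono (Subgroup.map_mono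
        ((Subgroup.zpowers_le (g := (c 1 * c 2 : PuncturedSurfaceGroup 0 4))).mpr node_mem_closureA))⟩,
    ⟨1, by
      rw [one_smul]
      exact Subgroup.topologicalClosure_mono (Subgroup.map_mono
        ((Subgroup.zpowers_le (g := (c 1 * c 2 : PuncturedSurfaceGroup 0 4))).mpr node_mem_closureB))⟩⟩
  cuspGp_le j := ⟨1, by
    rw [one_smul]
    fin_cases j
    · change M.cuspGp 0 ≤ M.vertGpB
      exact Subgroup.topologicalClosure_mono (Subgroup.map_mono
        ((Subgroup.zpowers_le (g := (c 0 : PuncturedSurfaceGroup 0 4))).mpr c_zero_mem_closureB))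
    · change M.cuspGp 1 ≤ M.vertGpA
      exact Subgroup.topologicalClosure_mono (Subgroup.map_mono
        ((Subgroup.zpowers_le (g := (c 1 : PuncturedSurfaceGroup 0 4))).mpr c_one_mem_closureA))
    · change M.cuspGp 2 ≤ M.vertGpA
      exact Subgroup.topologicalClosure_mono (Subgroup.map_mono
        ((Subgroup.zpowers_le (g := (c 2 : PuncturedSurfaceGroup 0 4))).mpr c_two_mem_closureA))
    · change M.cuspGp 3 ≤ M.vertGpB
      exact Subgroup.topologicalClosure_mono (Subgroup.map_mono
        ((Subgroup.zpowers_le (g := (c 3 : PuncturedSurfaceGroup 0 4))).mpr c_three_mem_closureB))⟩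
  proSigma := M.isProSigma_PiG

/-! ### The DPSC-index datum -/

/-- `Π_𝔾 ↪ P` has closed range. [cite: MochizukiAbsTopII2013, Def 1.2 (ii) p.10] -/
theorem isClosed_range_subtype : IsClosed (M.PiG.subtype.range : Set M.P) := by
  rw [Subgroup.range_subtype]; exact M.isClosed_PiG

/-- `Π_𝔾 ↪ P` has normal range. [cite: MochizukiAbsTopII2013, Def 1.2 (ii) p.10] -/
theorem normal_range_subtype : M.PiG.subtype.range.Normal := by
  rw [Subgroup.range_subtype]; exact M.normal_PiG

/-- **The DPSC-index datum of the degenerating 4-pointed sphere over the log point with inertia `I ≅ Ẑ^Σ` acting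
by the Dehn twist along the node** (abc-iut-f-069's `DPSCIndexData.ofEmbedding`): `Π_H = Π_I := P`,
`Π_𝔾 := closure ι(inl Γ_{0,4})`, two vertices / one (non-loop) node / four cusps with the representatives of
`pscDatum`, `Σ`-index of the node `i^Σ_e := 1` (Ex 1.1 (iii)).  The FIRST DPSC datum with TWO VERTICES in the
tree; every `Σ`. [cite: MochizukiAbsTopII2013, Def 1.2 (ii) p.10] -/
def dpsc (hne : Sigma.Nonempty) (hprime : ∀ p ∈ Sigma, p.Prime) : DPSCIndexData.{0} :=
  DPSCIndexData.ofEmbedding (M.pscDatum hne hprime) M.P M.PiG.subtype M.isClosed_range_subtype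
    M.normal_range_subtype ⊤ inferInstance le_top (fun _ => 1) (fun _ => IsSigmaInteger.one _)

/-- The DPSC data of `dpsc` is the embedded two-tripod datum (`rfl`). [cite: MochizukiAbsTopII2013, Def 1.2 (ii) p.10] -/
theorem dpsc_toDPSCData (hne : Sigma.Nonempty) (hprime : ∀ p ∈ Sigma, p.Prime) :
    (M.dpsc hne hprime).toDPSCData = DPSCData.ofEmbedding (M.pscDatum hne hprime) M.P M.PiG.subtype
      M.isClosed_range_subtype M.normal_range_subtype ⊤ inferInstance le_top := rfl

/-- The node of `dpsc` has `Σ`-index `1`. [cite: MochizukiAbsTopII2013, Ex 1.1 (iii) p.9] -/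
theorem dpsc_sigmaIndex (hne : Sigma.Nonempty) (hprime : ∀ p ∈ Sigma, p.Prime) (e : (M.dpsc hne hprime).Node) :
    (M.dpsc hne hprime).sigmaIndex e = 1 := rfl

/-- `Π_𝔾` of `dpsc` is `Π_𝔾 = closure ι(inl Γ_{0,4})`. [cite: MochizukiAbsTopII2013, Def 1.2 (ii) p.10] -/
theorem dpsc_PiG (hne : Sigma.Nonempty) (hprime : ∀ p ∈ Sigma, p.Prime) : (M.dpsc hne hprime).PiG = M.PiG :=
  Subgroup.range_subtype _

/-- `Π_I` of `dpsc` is all of `P`. [cite: MochizukiAbsTopII2013, Def 1.2 (ii) p.10] -/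
theorem dpsc_PiI (hne : Sigma.Nonempty) (hprime : ∀ p ∈ Sigma, p.Prime) : (M.dpsc hne hprime).PiI = ⊤ := rfl

/-- `dpsc` has two DISTINCT vertices, both ends of its node. [cite: MochizukiAbsTopII2013, Ex 1.1 (ii) p.9] -/
theorem dpsc_two_vertices (hne : Sigma.Nonempty) (hprime : ∀ p ∈ Sigma, p.Prime) :
    (⟨(0 : Fin 2)⟩ : (M.dpsc hne hprime).Vert) ≠ ⟨(1 : Fin 2)⟩ ∧
      ∀ (e : (M.dpsc hne hprime).Node),
        (M.dpsc hne hprime).nodeAbuts e ⟨(0 : Fin 2)⟩ ∧ (M.dpsc hne hprime).nodeAbuts e ⟨(1 : Fin 2)⟩ := by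
  refine ⟨fun h => ?_, fun e => ⟨?_, ?_⟩⟩
  · have := congrArg ULift.down h
    change (0 : Fin 2) = 1 at this
    exact absurd this (by decide)
  · change (0 : Fin 2) ∈ s((0 : Fin 2), (1 : Fin 2))
    exact Sym2.mem_mk_left _ _
  · change (1 : Fin 2) ∈ s((0 : Fin 2), (1 : Fin 2))
    exact Sym2.mem_mk_right _ _

end Model

end Literature.AnabelianGeometry.AbsoluteAnabelian.AbsTopII.TwoTripodNodal

end
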